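import Mathlib
import Summits.ValiantsHypothesis.ValiantsHypothesis.Theorems.NewtonUnitEquationsDissociatedUniformTotalsLaw
import Summits.ValiantsHypothesis.ValiantsHypothesis.Theorems.NewtonUnitEquationsDissociatedUniformTotalsLawUnion
import Summits.ValiantsHypothesis.ValiantsHypothesis.Theorems.NewtonUnitEquationsDissociatedUniformTotalsLawIntervalUnion
import Summits.ValiantsHypothesis.ValiantsHypothesis.Theorems.NewtonUnitEquationsDissociatedUniformTotalsLawIntervalUnionLogRuns
import Summits.ValiantsHypothesis.ValiantsHypothesis.Theorems.NewtonUnitEquationsDissociatedUniformTotalsLawIntervalUnionBands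
import HarnessLib

/-!
# Crux `NewtonUnitEquations.DissociatedUniform` (stmt-ValiantsHypothesis-5905), `n = 3` totals law of model (Q**):
# unions of `r` bands and third curves with few band-runs — arbitrary finite abelian group, arbitrary pairs

Corollaries of `…TotalsLawIntervalUnionBands.unionVert_band_le` (`#vert conv U_s(φ⁻¹[t,t+m)) ≤ 32|G|` for every homomorphism
`φ : G →+ ℤ/q`, all `a b : G → ℝ²`) and the subadditivity of fibre unions in the position set
(`…IntervalUnionLogRuns.unionVert_biUnion_le`):
* `unionVert_bands_le` — a position set that is a union of `r` bands `φ_i⁻¹[t_i, t_i+m_i)` (possibly for different homomorphisms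
  `φ_i`) has `#vert conv U_s(Z) ≤ r·32|G|` for every class; `unionTotal_bands_le` — `≤ r·32|G|²`;
* `classVert_le_of_bandRun_levels` / `totalVert_le_of_bandRun_levels` — a third curve with `≤ k` values, each level set a union of
  `≤ r` bands of one homomorphism `φ` (i.e. `c = g ∘ φ` with `g : ℤ/q → ℝ²` having `≤ r` runs per value), has `V_s ≤ k·r·32|G|`
  POINTWISE and `T(a,b,c) ≤ k·r·32|G|²`, for an ARBITRARY pair `a, b`.
Honest label: `UnionTotalsLaw C` and `TotalsLawThree C` remain OPEN and are asserted nowhere; nothing here bears on VP ≠ VNP. [folklore]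
-/

set_option linter.dupNamespace false -- `ValiantsHypothesis.ValiantsHypothesis` (summit = problem) in every name

open Finset
open scoped Pointwise

namespace Summit.ValiantsHypothesis.ValiantsHypothesis.Theorems.NewtonUnitEquationsDissociatedUniform

namespace TotalsLaw

section BandRuns

variable {G : Type*} [AddCommGroup G] [Fintype G] [DecidableEq G] {q : ℕ} [NeZero q]

/-- **Unions of `r` bands:** `#vert conv U_s(⋃_{i∈R} φ_i⁻¹[t_i, t_i+m_i)) ≤ |R|·32|G|` for all `a, b`, every class. -/
theorem unionVert_bands_le {ι : Type*} (a b : G → (Fin 2 → ℝ)) (R : Finset ι) (φ : ι → (G →+ ZMod q)) (t m : ι → ℕ)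
    (s : G) :
    unionVert a b (⋃ i ∈ R, (φ i) ⁻¹' (cycInterval q (t i) (m i) : Set (ZMod q))) s ≤ R.card * (32 * Fintype.card G) := by
  calc _ ≤ ∑ i ∈ R, unionVert a b ((φ i) ⁻¹' (cycInterval q (t i) (m i) : Set (ZMod q))) s := unionVert_biUnion_le a b R _ s
    _ ≤ ∑ _i ∈ R, 32 * Fintype.card G := Finset.sum_le_sum fun i _ => unionVert_band_le (φ i) a b (t i) (m i) s
    _ = R.card * (32 * Fintype.card G) := by rw [Finset.sum_const, smul_eq_mul]

/-- … and in total over the classes: `≤ |R|·32|G|²`. -/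
theorem unionTotal_bands_le {ι : Type*} (a b : G → (Fin 2 → ℝ)) (R : Finset ι) (φ : ι → (G →+ ZMod q)) (t m : ι → ℕ) :
    unionTotal a b (⋃ i ∈ R, (φ i) ⁻¹' (cycInterval q (t i) (m i) : Set (ZMod q))) ≤ R.card * (32 * Fintype.card G ^ 2) := by
  unfold unionTotal
  calc _ ≤ ∑ _s : G, R.card * (32 * Fintype.card G) := Finset.sum_le_sum fun s _ => unionVert_bands_le a b R φ t m s
    _ = R.card * (32 * Fintype.card G ^ 2) := by rw [Finset.sum_const, Finset.card_univ, smul_eq_mul]; ring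

/-- **The `n = 3` law, POINTWISE, for a third curve with few BAND-RUNS and an ARBITRARY pair:** if `c` takes `≤ k` values and every
level set of `c` is a union of `≤ r` bands of `φ`, then `V_s ≤ k·r·32|G|` for every class `s`. -/
theorem classVert_le_of_bandRun_levels (φ : G →+ ZMod q) (a b c : G → (Fin 2 → ℝ)) [DecidableEq (Fin 2 → ℝ)] {k r : ℕ}
    (hk : (Finset.univ.image c).card ≤ k)
    (hc : ∀ v, ∃ R : Finset (ℕ × ℕ), R.card ≤ r ∧ c ⁻¹' {v} = ⋃ p ∈ R, φ ⁻¹' (cycInterval q p.1 p.2 : Set (ZMod q)))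
    (s : G) : classVert a b c s ≤ k * (r * (32 * Fintype.card G)) := by
  calc classVert a b c s ≤ ∑ v ∈ Finset.univ.image c, unionVert a b (c ⁻¹' {v}) s :=
        classVert_le_sum_unionVert a b c s
    _ ≤ ∑ _v ∈ Finset.univ.image c, r * (32 * Fintype.card G) :=
        Finset.sum_le_sum fun v _ => by
          obtain ⟨R, hR, h⟩ := hc v
          rw [h]
          exact (unionVert_bands_le a b R (fun _ => φ) (fun p => p.1) (fun p => p.2) s).trans
            (Nat.mul_le_mul_right _ hR)
    _ ≤ k * (r * (32 * Fintype.card G)) := by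
        rw [Finset.sum_const, smul_eq_mul]
        exact Nat.mul_le_mul_right _ hk

/-- **… and in TOTAL:** `T(a,b,c) ≤ k·r·32|G|²` for `a, b` arbitrary and `c` with `≤ k` values whose level sets are unions of `≤ r`
bands of `φ`. -/
theorem totalVert_le_of_bandRun_levels (φ : G →+ ZMod q) (a b c : G → (Fin 2 → ℝ)) [DecidableEq (Fin 2 → ℝ)] {k r : ℕ}
    (hk : (Finset.univ.image c).card ≤ k)
    (hc : ∀ v, ∃ R : Finset (ℕ × ℕ), R.card ≤ r ∧ c ⁻¹' {v} = ⋃ p ∈ R, φ ⁻¹' (cycInterval q p.1 p.2 : Set (ZMod q))) :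
    totalVert a b c ≤ k * (r * (32 * Fintype.card G ^ 2)) := by
  unfold totalVert
  calc ∑ s, classVert a b c s ≤ ∑ _s : G, k * (r * (32 * Fintype.card G)) :=
        Finset.sum_le_sum fun s _ => classVert_le_of_bandRun_levels φ a b c hk hc s
    _ = k * (r * (32 * Fintype.card G ^ 2)) := by rw [Finset.sum_const, Finset.card_univ, smul_eq_mul]; ring

end BandRuns

end TotalsLaw

end Summit.ValiantsHypothesis.ValiantsHypothesis.Theorems.NewtonUnitEquationsDissociatedUniform
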